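import Mathlib.LinearAlgebra.Dimension.Constructions
import Mathlib.LinearAlgebra.Dimension.Finite
import Mathlib.LinearAlgebra.FiniteDimensional.Basic
import Mathlib.LinearAlgebra.LinearIndependent.Lemmas
import HarnessLib

/-!
# Outer products of coordinate vectors: linear independence and the dimension of their span

Topic `Literature/Computability/AlgebraicComplexity`. Pure linear algebra over a field `K`, with
Mathlib-only imports:

* `finrank_span_range_comp_linearEquiv` — transporting a family of vectors along a linear
  equivalence does not change the dimension of its span;
* `span_range_comp_of_surjective` — reindexing a family along a surjection does not change its span;
* `outerFun y x` — the outer product `(p, q) ↦ y p · x q` of two coordinate vectors, `outerFun_apply`;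
* `linearIndependent_outerFun` — outer products `yᵢ ⊠ xⱼ` of two linearly independent families are
  linearly independent;
* `finrank_span_outerFun` — **`dim span{yᵢ ⊠ xⱼ} = dim span{yᵢ} · dim span{xⱼ}`** (the rank of a
  Kronecker product of matrices is the product of the ranks).

## Why this file exists (hygiene split of `FlatteningRank.lean`)

These six declarations are VERBATIM copies (statements and proofs) of the declarations of the same
short names in `FlatteningRank.lean` (ll. 96–110, 178–260 there), where they serve the
multiplicativity of the flattening rank `ζ⁽¹⁾`. They are also the only thing the
Limaye–Srinivasan–Tavenas relative-rank file `RelativeRank.lean` needs from `FlatteningRank.lean`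
("the matrix of a product is the Kronecker product"); importing them from here instead keeps the
closure of `RelativeRank.lean` (and of every route using the LST vocabulary) at
`SetMultilinear` + Mathlib, free of the asymptotic-spectrum / matrix-multiplication-exponent stack
that `FlatteningRank.lean` imports.

They live in the sub-namespace `Literature.Computability.AlgebraicComplexity.OuterProductRank`
(users `open OuterProductRank`): one fully-qualified name is declared by one module only, and the
unqualified names are still declared by `FlatteningRank.lean` for its own importers
(`FlatteningRankCube`, `KoszulFlatteningKronecker`). Deliberately NOT here: slices, `flatteningRank`,
tensors of any kind.

## References

Standard linear algebra [folklore]; for `finrank_span_outerFun` cf. R. A. Horn, C. R. Johnson,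
*Topics in Matrix Analysis* (1991), Theorem 4.2.15 (`rank (A ⊗ B) = rank A · rank B`).

## Mathlib

`exists_linearIndependent'`, `finrank_span_eq_card`, `finrank_range_le_card`,
`LinearIndependent.fintype_card_le_finrank`, `Submodule.finrank_mono`, `LinearEquiv.finrank_map_eq`.
Mathlib (at the pin) has no rank-of-Kronecker-product lemma for matrices or for functions on a
product type (searched `rank_kronecker`, `finrank_tensorProduct`, `finrank_span_range`).
-/

noncomputable section

open scoped BigOperators
open Module Submodule

namespace Literature.Computability.AlgebraicComplexity.OuterProductRank

universe u

variable {K : Type u} [Field K]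

variable {ι ι' : Type*}

/-! ## Span dimension under a linear equivalence / a surjective reindexing -/

/-- Transporting a family of vectors along a linear equivalence does not change the dimension of
its span. [folklore] -/
theorem finrank_span_range_comp_linearEquiv {V W : Type*} [AddCommGroup V] [Module K V]
    [AddCommGroup W] [Module K W] (L : V ≃ₗ[K] W) (v : ι → V) :
    finrank K (span K (Set.range (L ∘ v))) = finrank K (span K (Set.range v)) := by
  have : Set.range (L ∘ v) = (L : V →ₗ[K] W) '' Set.range v := by
    rw [Set.range_comp]; rfl
  rw [this, Submodule.span_image]
  exact LinearEquiv.finrank_map_eq L _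

/-- Precomposing the index of a family with a surjection does not change its span. [folklore] -/
theorem span_range_comp_of_surjective {V : Type*} [AddCommGroup V] [Module K V] (v : ι → V)
    {f : ι' → ι} (hf : Function.Surjective f) :
    span K (Set.range (v ∘ f)) = span K (Set.range v) := by
  rw [Set.range_comp, hf.range_eq, Set.image_univ]

/-! ## Outer products of coordinate vectors -/

/-- Outer product of coordinate vectors: `(y ⊠ x)(p, q) = y p · x q`. [folklore] -/
def outerFun {X X' : Type*} (y : X → K) (x : X' → K) : X × X' → K := fun p => y p.1 * x p.2

/-- Entries of the outer product. [folklore] -/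
@[simp] theorem outerFun_apply {X X' : Type*} (y : X → K) (x : X' → K) (p : X × X') :
    outerFun y x p = y p.1 * x p.2 := rfl

/-- **Outer products of linearly independent families are linearly independent.** [folklore] -/
theorem linearIndependent_outerFun {X X' ι₁ ι₂ : Type*} [Fintype ι₁] [Fintype ι₂] {y : ι₁ → X → K}
    {x : ι₂ → X' → K} (hy : LinearIndependent K y) (hx : LinearIndependent K x) :
    LinearIndependent K (fun kk : ι₁ × ι₂ => outerFun (y kk.1) (x kk.2)) := by
  rw [Fintype.linearIndependent_iff] at hy hx ⊢
  intro g hg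
  -- for each `q`, the `y`-coefficients `Σ_{k'} g (k, k') x_{k'}(q)` vanish
  have h1 : ∀ q k, (∑ k', g (k, k') * x k' q) = 0 := by
    intro q
    refine hy (fun k => ∑ k', g (k, k') * x k' q) ?_
    funext p
    have := congrFun hg (p, q)
    simp only [Finset.sum_apply, Pi.smul_apply, smul_eq_mul, outerFun_apply, Pi.zero_apply,
      Fintype.sum_prod_type] at this
    simp only [Finset.sum_apply, Pi.smul_apply, smul_eq_mul, Pi.zero_apply]
    rw [← this]
    refine Finset.sum_congr rfl fun k _ => ?_
    rw [Finset.sum_mul]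
    exact Finset.sum_congr rfl fun k' _ => by ring
  rintro ⟨k, k'⟩
  refine hx (fun k' => g (k, k')) ?_ k'
  funext q
  simp only [Finset.sum_apply, Pi.smul_apply, smul_eq_mul, Pi.zero_apply]
  exact h1 q k

/-- **The span of all outer products `y_i ⊠ x_j` has dimension `dim span{y_i} · dim span{x_j}`**
(rank of a Kronecker product of matrices). [folklore] -/
theorem finrank_span_outerFun {X X' : Type*} [Fintype X] [Fintype X'] [Fintype ι] [Fintype ι']
    (y : ι → X → K) (x : ι' → X' → K) :
    finrank K (span K (Set.range fun kk : ι × ι' => outerFun (y kk.1) (x kk.2))) =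
      finrank K (span K (Set.range y)) * finrank K (span K (Set.range x)) := by
  classical
  obtain ⟨κ₁, a₁, ha₁, hspan₁, hli₁⟩ := exists_linearIndependent' K y
  obtain ⟨κ₂, a₂, ha₂, hspan₂, hli₂⟩ := exists_linearIndependent' K x
  haveI : Fintype κ₁ := Fintype.ofInjective a₁ ha₁
  haveI : Fintype κ₂ := Fintype.ofInjective a₂ ha₂
  have n₁ : finrank K (span K (Set.range y)) = Fintype.card κ₁ := by
    rw [← hspan₁, finrank_span_eq_card hli₁]
  have n₂ : finrank K (span K (Set.range x)) = Fintype.card κ₂ := by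
    rw [← hspan₂, finrank_span_eq_card hli₂]
  set W := span K (Set.range fun kk : ι × ι' => outerFun (y kk.1) (x kk.2)) with hW
  set F : κ₁ × κ₂ → (X × X' → K) := fun kk => outerFun (y (a₁ kk.1)) (x (a₂ kk.2)) with hF
  have hFli : LinearIndependent K F :=
    linearIndependent_outerFun (y := y ∘ a₁) (x := x ∘ a₂) hli₁ hli₂
  have hFmem : ∀ kk, F kk ∈ W := fun kk => subset_span ⟨(a₁ kk.1, a₂ kk.2), rfl⟩
  refine le_antisymm ?_ ?_
  · -- `W ≤ span (range F)`
    have hle : W ≤ span K (Set.range F) := by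
      rw [hW, Submodule.span_le]
      rintro _ ⟨⟨i, i'⟩, rfl⟩
      have hyi : y i ∈ span K (Set.range (y ∘ a₁)) := by rw [hspan₁]; exact subset_span ⟨i, rfl⟩
      have hxi : x i' ∈ span K (Set.range (x ∘ a₂)) := by rw [hspan₂]; exact subset_span ⟨i', rfl⟩
      obtain ⟨c, hc⟩ := (Submodule.mem_span_range_iff_exists_fun K).1 hyi
      obtain ⟨d, hd⟩ := (Submodule.mem_span_range_iff_exists_fun K).1 hxi
      have : outerFun (y i) (x i') = ∑ kk : κ₁ × κ₂, (c kk.1 * d kk.2) • F kk := by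
        funext p
        rw [outerFun_apply, ← hc, ← hd, Finset.sum_apply, Finset.sum_apply, Finset.sum_apply,
          Finset.sum_mul_sum, Fintype.sum_prod_type]
        refine Finset.sum_congr rfl fun k _ => Finset.sum_congr rfl fun k' _ => ?_
        simp only [Pi.smul_apply, smul_eq_mul, Function.comp_apply, hF, outerFun_apply]
        ring
      dsimp only
      rw [this]
      exact Submodule.sum_mem _ fun kk _ => Submodule.smul_mem _ _ (subset_span ⟨kk, rfl⟩)
    calc finrank K W ≤ finrank K (span K (Set.range F)) := Submodule.finrank_mono hle
      _ ≤ Fintype.card (κ₁ × κ₂) := finrank_range_le_card F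
      _ = _ := by rw [Fintype.card_prod, n₁, n₂]
  · -- `card (κ₁ × κ₂)` independent vectors inside `W`
    set F' : κ₁ × κ₂ → W := fun kk => ⟨F kk, hFmem kk⟩ with hF'
    have hcomp : W.subtype ∘ F' = F := rfl
    have hF'li : LinearIndependent K F' := LinearIndependent.of_comp W.subtype (hcomp ▸ hFli)
    have hle : Fintype.card (κ₁ × κ₂) ≤ finrank K W := hF'li.fintype_card_le_finrank
    rw [n₁, n₂, ← Fintype.card_prod]
    exact hle

end Literature.Computability.AlgebraicComplexity.OuterProductRank

end
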